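import Mathlib
import Summits.CriticalPhenomena.CardyFormulaZ2.Theorems.CardySelfRefinementGradientComparabilityStubNonAxialShareBulkLeaf
import HarnessLib

/-!
# Local surgery around a pivotal axial edge: level 3 and the two drivers

Helper file for the stub `stub_nonAxialShare_bulk` (D4-bulk) of the line `Sketch` (crux
`stmt-CriticalPhenomena-10269`, `…Theses.CardySelfRefinement.GradientComparability`), continuing
`…BulkLeaf.lean`.

* **level 3** (`level3`): when the posts at the feeding cell are not admissible and both feeding
  cells fail too, `c = V (-1) 0` has degree two in `σ` (fed by `cc = V (-2) 0`, by the
  isolated-edge lemma), and on side `+1` the post `{cc, cc'}` or the rail `{cc', c'}` becomes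
  pivotal after closing `e` and the two feeding edges and opening the detour
  `cc → cc' → c' → c → p → q` — both failing would link `cc'` to both sides;
* the drivers `driver_onePost` (the line across `e` through `p` is a coarse line: rails, far
  posts and the feeding-cell post/rail are admissible; levels 1, 1, 2) and `driver_twoPost`
  (registered sub-goal; neither line through the ends of `e` is coarse: near posts admissible too,
  feeding-cell posts not; levels 1, 1, 2, 2, 3).  The chain of failures always terminates: no
  Jordan-curve exclusion is needed.

No percolation, no named fact.
-/

noncomputable section

namespace Summit.CriticalPhenomena.CardyFormulaZ2.Theorems.CardySelfRefinement

open scoped Topology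
open Filter Set MeasureTheory Metric
open Literature.Probability.LatticeModels Literature.Probability.Percolation
open Literature.Probability.Percolation.QuadCrossing
open Summit.CriticalPhenomena.CardyFormulaZ2.Theses.CardySelfRefinement

variable {D : Set ℂ} {δ : ℝ}

/-- **Level 3** (only reached when the posts `f_c` are not admissible).  Both cells beside `e`
and both cells beside the feeding edge failed: then `c = V (-1) 0` has degree two in `σ` (fed by
`cc = V (-2) 0`), and on side `+1` one of the admissible `f_cc = {V (-2) 0, V (-2) 1}`,
`ê_cc = {V (-2) 1, V (-1) 1}` becomes pivotal after closing `e` and the two feeding edges and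
opening the detour `cc → cc' → c' → c → p → q` — both failing would link `V (-2) 1` to both
sides. -/
theorem level3 (hδ : 0 < δ) (Q : Quad D) {σ : BondConfig (Site 2)} {jp jq : Fin 4}
    (hj : (jp = 0 ∧ jq = 2) ∨ (jp = 2 ∧ jq = 0))
    (hσ : ¬ ∃ a ∈ Q.side 0, ∃ b ∈ Q.side 2, JoinedIn (Q.carrier ∩ openEdgeUnion δ σ) a b)
    {V : ℤ → ℤ → Site 2} {p u w : Site 2} (hV : ∀ a b, V a b = p + a • u + b • w)
    (hfr : ((u = ![1, 0] ∨ u = ![-1, 0]) ∧ (w = ![0, 1] ∨ w = ![0, -1])) ∨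
      ((u = ![0, 1] ∨ u = ![0, -1]) ∧ (w = ![1, 0] ∨ w = ![-1, 0])))
    (hball : Metric.closedBall (meshPoint δ p) (4 * δ) ⊆ interior Q.carrier)
    (he : s(V 0 0, V 1 0) ∉ σ)
    (hpL : ∃ a ∈ Q.side jp, JoinedIn (Q.carrier ∩ openEdgeUnion δ σ) a (meshPoint δ (V 0 0))) (hpR : ¬ ∃ a ∈ Q.side jq, JoinedIn (Q.carrier ∩ openEdgeUnion δ σ) a (meshPoint δ (V 0 0))) (hqR : ∃ a ∈ Q.side jq, JoinedIn (Q.carrier ∩ openEdgeUnion δ σ) a (meshPoint δ (V 1 0))) (hqL : ¬ ∃ a ∈ Q.side jp, JoinedIn (Q.carrier ∩ openEdgeUnion δ σ) a (meshPoint δ (V 1 0)))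
    (hup : ∃ a ∈ Q.side jq, JoinedIn (Q.carrier ∩ openEdgeUnion δ σ) a (meshPoint δ (V 0 1))) (hdn : ∃ a ∈ Q.side jq, JoinedIn (Q.carrier ∩ openEdgeUnion δ σ) a (meshPoint δ (V 0 (-1)))) (hcup : ∃ a ∈ Q.side jq, JoinedIn (Q.carrier ∩ openEdgeUnion δ σ) a (meshPoint δ (V (-1) 1))) (hcdn : ∃ a ∈ Q.side jq, JoinedIn (Q.carrier ∩ openEdgeUnion δ σ) a (meshPoint δ (V (-1) (-1))))
    {Adm : Sym2 (Site 2) → Prop}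
    (hAf : Adm s(V (-2) 0, V (-2) 1)) (hAê : Adm s(V (-2) 1, V (-1) 1)) :
    ∃ (Rm S : Set (Sym2 (Site 2))) (e' : Sym2 (Site 2)), s(V 0 0, V 1 0) ∈ Rm ∧ e' ∈ S ∧ Adm e' ∧
      (∀ r ∈ Rm ∪ S, ∃ x y, r = s(x, y) ∧ (zdGraph 2).Adj x y ∧
        ∀ i, |x i - p i| ≤ 3 ∧ |y i - p i| ≤ 3) ∧
      IsPreconnected (openEdgeUnion δ S) ∧ (∀ r ∈ Rm, ∀ x ∈ r, meshPoint δ x ∈ openEdgeUnion δ S) ∧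
      ¬ ∃ a ∈ Q.side 0, ∃ b ∈ Q.side 2,
        JoinedIn (Q.carrier ∩ openEdgeUnion δ (σ \ Rm ∪ (S \ {e'}))) a b := by
  obtain ⟨hfeed, hleaf, hcL, hcR⟩ := leaf_facts hδ Q hj hσ hV hfr hball he hpL hpR hup hdn
  have hI : ∀ a b a' b' : ℤ, |(a : ℝ)| + |(b : ℝ)| ≤ 4 → |(a' : ℝ)| + |(b' : ℝ)| ≤ 4 →
      segment ℝ (meshPoint δ (V a b)) (meshPoint δ (V a' b')) ⊆ interior Q.carrier :=
    fun a b a' b' h h' => frame_segment_subset_interior hδ Q hV hfr hball h h'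
  have hpc : (zdGraph 2).Adj (V 0 0) (V (-1) 0) := frame_adj hV hfr (by norm_num)
  have hccc : (zdGraph 2).Adj (V (-1) 0) (V (-2) 0) := frame_adj hV hfr (by norm_num)
  -- the perpendicular edges at `c` are closed
  have hcclosed : ∀ t : ℤ, t = 1 ∨ t = -1 → (∃ a ∈ Q.side jq, JoinedIn (Q.carrier ∩ openEdgeUnion δ σ) a (meshPoint δ (V (-1) t))) → s(V (-1) 0, V (-1) t) ∉ σ := by
    intro t ht hlk hmem
    have hadj : (zdGraph 2).Adj (V (-1) 0) (V (-1) t) :=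
      frame_adj hV hfr (by rcases ht with rfl | rfl <;> norm_num)
    have hJ := joinedIn_of_adj_mem δ Q hadj hmem ((hI (-1) 0 (-1) t (by norm_num)
      (by rcases ht with rfl | rfl <;> norm_num)).trans interior_subset)
    exact hcR (link_of_joinedIn hlk hJ.symm)
  -- the second feeding edge is open (else `{c, p}` would be an isolated open edge)
  have hfeed2 : s(V (-1) 0, V (-2) 0) ∈ σ := by
    by_contra hno
    have hc : ∀ y, (zdGraph 2).Adj (V (-1) 0) y → s(V (-1) 0, y) ∈ σ → y = V 0 0 := by
      intro y hy hmem
      rcases frame_neighbours hV hfr hy with rfl | rfl | rfl | rfl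
      · norm_num
      · exact absurd hmem (by norm_num; exact hno)
      · exact absurd hmem (by norm_num; exact hcclosed 1 (Or.inl rfl) hcup)
      · exact absurd hmem (by norm_num; exact hcclosed (-1) (Or.inr rfl) hcdn)
    obtain ⟨a, ha, hJ⟩ := hpL
    set γ := hJ.somePath
    have hsub := subset_segment_of_isolated_edge hδ hpc.symm hc hleaf
      (isConnected_range γ.continuous).isPreconnected (fun z ⟨s', hs'⟩ => hs' ▸ (hJ.somePath_mem s').2)
      ⟨meshPoint δ (V 0 0), ⟨1, γ.target⟩, right_mem_segment ℝ _ _⟩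
    have ha' : a ∈ interior Q.carrier := hI (-1) 0 0 0 (by norm_num) (by norm_num) (hsub ⟨0, γ.source⟩)
    exact notMem_side_of_mem_interior Q ha' jp ha
  have hleafc : ∀ y, (zdGraph 2).Adj (V (-1) 0) y → s(V (-1) 0, y) ∈ σ → y = V 0 0 ∨ y = V (-2) 0 := by
    intro y hy hmem
    rcases frame_neighbours hV hfr hy with rfl | rfl | rfl | rfl
    · left; norm_num
    · right; norm_num
    · exact absurd hmem (by norm_num; exact hcclosed 1 (Or.inl rfl) hcup)
    · exact absurd hmem (by norm_num; exact hcclosed (-1) (Or.inr rfl) hcdn)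
  have hccR : ¬ ∃ a ∈ Q.side jq, JoinedIn (Q.carrier ∩ openEdgeUnion δ σ) a (meshPoint δ (V (-2) 0)) := fun h =>
    hcR (link_of_joinedIn h (joinedIn_of_adj_mem δ Q hccc.symm (by rw [Sym2.eq_swap]; exact hfeed2)
      ((hI (-2) 0 (-1) 0 (by norm_num) (by norm_num)).trans interior_subset)))
  have hint : ∀ S : Set (Sym2 (Site 2)), (∀ r ∈ S, ∃ a b a' b' : ℤ, r = s(V a b, V a' b') ∧
      |(a : ℝ)| + |(b : ℝ)| ≤ 4 ∧ |(a' : ℝ)| + |(b' : ℝ)| ≤ 4) →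
      ∀ z ∈ openEdgeUnion δ S, z ∈ interior Q.carrier := fun S hS =>
    openEdgeUnion_subset_of_forall fun x y _ hxy => by
      obtain ⟨a, b, a', b', hr, h, h'⟩ := hS _ hxy
      rw [segment_meshPoint_eq_of_sym2_eq δ hr]; exact hI a b a' b' h h'
  by_cases h : ∃ a ∈ Q.side jq, JoinedIn (Q.carrier ∩ openEdgeUnion δ σ) a (meshPoint δ (V (-2) 1))
  · -- the post `f_cc` works
    have hcc'L : ¬ ∃ a ∈ Q.side jp, JoinedIn (Q.carrier ∩ openEdgeUnion δ σ) a (meshPoint δ (V (-2) 1)) := fun h' => hσ (crossing_of_two_links Q hj h' h)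
    have key := not_crossing_lev3_end hδ Q hj hσ (q := V 1 0) (cc' := V (-2) 1) (c' := V (-1) 1)
      hpc hccc hleaf hleafc (hint _ fun r hr => by
        rcases hr with rfl | rfl | rfl | hr
        · exact ⟨-2, 1, -1, 1, rfl, by norm_num, by norm_num⟩
        · exact ⟨-1, 1, -1, 0, rfl, by norm_num, by norm_num⟩
        · exact ⟨-1, 0, 0, 0, rfl, by norm_num, by norm_num⟩
        · rw [Set.mem_singleton_iff.1 hr]; exact ⟨0, 0, 1, 0, rfl, by norm_num, by norm_num⟩)
      hqL hcup hcc'L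
    refine out_level3 δ Q hV hfr (Or.inl rfl) hAf fun ⟨a, ha, b, hb, hJ⟩ =>
      key ⟨a, ha, b, hb, joinedIn_mono_config δ Q ?_ hJ⟩
    rintro x (hx | ⟨hx | hx | hx | hx | hx, hne⟩)
    · exact Or.inl (Or.inl ⟨hx.1, fun h' => hx.2 (Or.inr h')⟩)
    · exact absurd hx hne
    · exact Or.inr (Or.inl hx)
    · exact Or.inr (Or.inr (Or.inl hx))
    · exact Or.inr (Or.inr (Or.inr (Or.inl hx)))
    · exact Or.inr (Or.inr (Or.inr (Or.inr hx)))
  · -- the rail `ê_cc` works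
    have key := not_crossing_lev3_mid hδ Q hj hσ (q := V 1 0) (cc' := V (-2) 1) (c' := V (-1) 1)
      hpc hccc (frame_adj hV hfr (by norm_num)) (frame_adj hV hfr (by norm_num))
      (frame_adj hV hfr (by norm_num)) (frame_adj hV hfr (by norm_num))
      (frame_ne hV hfr (Or.inl (by norm_num))) (frame_ne hV hfr (Or.inl (by norm_num)))
      (frame_ne hV hfr (Or.inl (by norm_num))) (frame_ne hV hfr (Or.inl (by norm_num)))
      (frame_ne hV hfr (Or.inl (by norm_num))) (frame_ne hV hfr (Or.inl (by norm_num)))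
      (frame_ne hV hfr (Or.inl (by norm_num))) (frame_ne hV hfr (Or.inl (by norm_num)))
      hleaf hleafc (hint _ fun r hr => by
        rcases hr with rfl | rfl | rfl | hr
        · exact ⟨-2, 0, -2, 1, rfl, by norm_num, by norm_num⟩
        · exact ⟨-1, 1, -1, 0, rfl, by norm_num, by norm_num⟩
        · exact ⟨-1, 0, 0, 0, rfl, by norm_num, by norm_num⟩
        · rw [Set.mem_singleton_iff.1 hr]; exact ⟨0, 0, 1, 0, rfl, by norm_num, by norm_num⟩)
      hqR hqL hcup hccR h
    refine out_level3 δ Q hV hfr (Or.inr (Or.inl rfl)) hAê fun ⟨a, ha, b, hb, hJ⟩ =>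
      key ⟨a, ha, b, hb, joinedIn_mono_config δ Q ?_ hJ⟩
    rintro x (hx | ⟨hx | hx | hx | hx | hx, hne⟩)
    · exact Or.inl (Or.inl ⟨hx.1, fun h' => hx.2 (Or.inr h')⟩)
    · exact Or.inl (Or.inr hx)
    · exact absurd hx hne
    · exact Or.inr (Or.inl hx)
    · exact Or.inr (Or.inr (Or.inl hx))
    · exact Or.inr (Or.inr (Or.inr hx))

/-! ## The two drivers -/

/-- **Driver, one-post case** (the perpendicular edges at `V 0 0` are axial, so the rails
`ê(±) = {V 0 (±1), V 1 (±1)}`, the far posts `g(±) = {V 1 0, V 1 (±1)}`, and at the feeding cell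
the post `f_c = {V (-1) 0, V (-1) 1}` and rail `ê_c = {V (-1) 1, V 0 1}` are admissible): some
admissible edge becomes pivotal after a local modification (levels 1, 1, 2). -/
theorem driver_onePost (hδ : 0 < δ) (Q : Quad D) {σ : BondConfig (Site 2)} {jp jq : Fin 4}
    (hj : (jp = 0 ∧ jq = 2) ∨ (jp = 2 ∧ jq = 0))
    (hσ : ¬ ∃ a ∈ Q.side 0, ∃ b ∈ Q.side 2, JoinedIn (Q.carrier ∩ openEdgeUnion δ σ) a b)
    {V : ℤ → ℤ → Site 2} {p u w : Site 2} (hV : ∀ a b, V a b = p + a • u + b • w)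
    (hfr : ((u = ![1, 0] ∨ u = ![-1, 0]) ∧ (w = ![0, 1] ∨ w = ![0, -1])) ∨
      ((u = ![0, 1] ∨ u = ![0, -1]) ∧ (w = ![1, 0] ∨ w = ![-1, 0])))
    (hball : Metric.closedBall (meshPoint δ p) (4 * δ) ⊆ interior Q.carrier)
    (he : s(V 0 0, V 1 0) ∉ σ)
    (hpL : ∃ a ∈ Q.side jp, JoinedIn (Q.carrier ∩ openEdgeUnion δ σ) a (meshPoint δ (V 0 0))) (hpR : ¬ ∃ a ∈ Q.side jq, JoinedIn (Q.carrier ∩ openEdgeUnion δ σ) a (meshPoint δ (V 0 0))) (hqR : ∃ a ∈ Q.side jq, JoinedIn (Q.carrier ∩ openEdgeUnion δ σ) a (meshPoint δ (V 1 0))) (hqL : ¬ ∃ a ∈ Q.side jp, JoinedIn (Q.carrier ∩ openEdgeUnion δ σ) a (meshPoint δ (V 1 0)))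
    {Adm : Sym2 (Site 2) → Prop}
    (hA₁ : Adm s(V 0 1, V 1 1)) (hA₂ : Adm s(V 0 (-1), V 1 (-1)))
    (hA₃ : Adm s(V 1 0, V 1 1)) (hA₄ : Adm s(V 1 0, V 1 (-1)))
    (hA₅ : Adm s(V (-1) 0, V (-1) 1)) (hA₆ : Adm s(V (-1) 1, V 0 1)) :
    ∃ (Rm S : Set (Sym2 (Site 2))) (e' : Sym2 (Site 2)), s(V 0 0, V 1 0) ∈ Rm ∧ e' ∈ S ∧ Adm e' ∧
      (∀ r ∈ Rm ∪ S, ∃ x y, r = s(x, y) ∧ (zdGraph 2).Adj x y ∧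
        ∀ i, |x i - p i| ≤ 3 ∧ |y i - p i| ≤ 3) ∧
      IsPreconnected (openEdgeUnion δ S) ∧ (∀ r ∈ Rm, ∀ x ∈ r, meshPoint δ x ∈ openEdgeUnion δ S) ∧
      ¬ ∃ a ∈ Q.side 0, ∃ b ∈ Q.side 2,
        JoinedIn (Q.carrier ∩ openEdgeUnion δ (σ \ Rm ∪ (S \ {e'}))) a b := by
  by_cases hup : ∃ a ∈ Q.side jq, JoinedIn (Q.carrier ∩ openEdgeUnion δ σ) a (meshPoint δ (V 0 1))
  · by_cases hdn : ∃ a ∈ Q.side jq, JoinedIn (Q.carrier ∩ openEdgeUnion δ σ) a (meshPoint δ (V 0 (-1)))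
    · exact level2 hδ Q hj hσ hV hfr hball he hpL hpR hqR hqL hup hdn (Or.inl rfl) hA₆ (Or.inl hA₅)
    · exact level1 hδ Q hj hσ hV hfr hball hpL hpR hqR hqL (Or.inr rfl) hA₂ hA₄ (Or.inr hdn)
        (fun h => hdn h.1)
  · exact level1 hδ Q hj hσ hV hfr hball hpL hpR hqR hqL (Or.inl rfl) hA₁ hA₃ (Or.inr hup)
      (fun h => hup h.1)

/-- **Driver, two-post case** (neither perpendicular line through the ends of `e` is axial, so
the near posts `f(±) = {V 0 0, V 0 (±1)}` are admissible too, but the posts at the feeding cells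
are not): some admissible edge becomes pivotal after a local modification (levels 1, 1, 2, 2, 3).
No planar-topology exclusion is needed: the chain of failures ends at level 3. -/
theorem driver_twoPost {D : Set ℂ} {δ : ℝ} (hδ : 0 < δ) (Q : Quad D) {σ : BondConfig (Site 2)} {jp jq : Fin 4}
    (hj : (jp = 0 ∧ jq = 2) ∨ (jp = 2 ∧ jq = 0))
    (hσ : ¬ ∃ a ∈ Q.side 0, ∃ b ∈ Q.side 2, JoinedIn (Q.carrier ∩ openEdgeUnion δ σ) a b)
    {V : ℤ → ℤ → Site 2} {p u w : Site 2} (hV : ∀ a b, V a b = p + a • u + b • w)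
    (hfr : ((u = ![1, 0] ∨ u = ![-1, 0]) ∧ (w = ![0, 1] ∨ w = ![0, -1])) ∨
      ((u = ![0, 1] ∨ u = ![0, -1]) ∧ (w = ![1, 0] ∨ w = ![-1, 0])))
    (hball : Metric.closedBall (meshPoint δ p) (4 * δ) ⊆ interior Q.carrier)
    (he : s(V 0 0, V 1 0) ∉ σ)
    (hpL : ∃ a ∈ Q.side jp, JoinedIn (Q.carrier ∩ openEdgeUnion δ σ) a (meshPoint δ (V 0 0))) (hpR : ¬ ∃ a ∈ Q.side jq, JoinedIn (Q.carrier ∩ openEdgeUnion δ σ) a (meshPoint δ (V 0 0))) (hqR : ∃ a ∈ Q.side jq, JoinedIn (Q.carrier ∩ openEdgeUnion δ σ) a (meshPoint δ (V 1 0))) (hqL : ¬ ∃ a ∈ Q.side jp, JoinedIn (Q.carrier ∩ openEdgeUnion δ σ) a (meshPoint δ (V 1 0)))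
    {Adm : Sym2 (Site 2) → Prop}
    (hA₁ : Adm s(V 0 1, V 1 1)) (hA₂ : Adm s(V 0 (-1), V 1 (-1)))
    (hA₃ : Adm s(V 1 0, V 1 1)) (hA₄ : Adm s(V 1 0, V 1 (-1)))
    (hA₅ : Adm s(V 0 0, V 0 1)) (hA₆ : Adm s(V 0 0, V 0 (-1)))
    (hA₇ : Adm s(V (-1) 1, V 0 1)) (hA₈ : Adm s(V (-1) (-1), V 0 (-1)))
    (hA₉ : Adm s(V (-2) 0, V (-2) 1)) (hA₀ : Adm s(V (-2) 1, V (-1) 1)) :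
    ∃ (Rm S : Set (Sym2 (Site 2))) (e' : Sym2 (Site 2)), s(V 0 0, V 1 0) ∈ Rm ∧ e' ∈ S ∧ Adm e' ∧
      (∀ r ∈ Rm ∪ S, ∃ x y, r = s(x, y) ∧ (zdGraph 2).Adj x y ∧
        ∀ i, |x i - p i| ≤ 3 ∧ |y i - p i| ≤ 3) ∧
      IsPreconnected (openEdgeUnion δ S) ∧ (∀ r ∈ Rm, ∀ x ∈ r, meshPoint δ x ∈ openEdgeUnion δ S) ∧
      ¬ ∃ a ∈ Q.side 0, ∃ b ∈ Q.side 2,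
        JoinedIn (Q.carrier ∩ openEdgeUnion δ (σ \ Rm ∪ (S \ {e'}))) a b := by
  by_cases h1 : (∃ a ∈ Q.side jq, JoinedIn (Q.carrier ∩ openEdgeUnion δ σ) a (meshPoint δ (V 0 1))) ∧ ∃ a ∈ Q.side jp, JoinedIn (Q.carrier ∩ openEdgeUnion δ σ) a (meshPoint δ (V 1 1))
  · by_cases h2 : (∃ a ∈ Q.side jq, JoinedIn (Q.carrier ∩ openEdgeUnion δ σ) a (meshPoint δ (V 0 (-1)))) ∧ ∃ a ∈ Q.side jp, JoinedIn (Q.carrier ∩ openEdgeUnion δ σ) a (meshPoint δ (V 1 (-1)))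
    · by_cases h3 : ∃ a ∈ Q.side jq, JoinedIn (Q.carrier ∩ openEdgeUnion δ σ) a (meshPoint δ (V (-1) 1))
      · by_cases h4 : ∃ a ∈ Q.side jq, JoinedIn (Q.carrier ∩ openEdgeUnion δ σ) a (meshPoint δ (V (-1) (-1)))
        · exact level3 hδ Q hj hσ hV hfr hball he hpL hpR hqR hqL h1.1 h2.1 h3 h4 hA₉ hA₀
        · exact level2 hδ Q hj hσ hV hfr hball he hpL hpR hqR hqL h1.1 h2.1 (Or.inr rfl) hA₈
            (Or.inr h4)
      · exact level2 hδ Q hj hσ hV hfr hball he hpL hpR hqR hqL h1.1 h2.1 (Or.inl rfl) hA₇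
          (Or.inr h3)
    · exact level1 hδ Q hj hσ hV hfr hball hpL hpR hqR hqL (Or.inr rfl) hA₂ hA₄ (Or.inl hA₆) h2
  · exact level1 hδ Q hj hσ hV hfr hball hpL hpR hqR hqL (Or.inl rfl) hA₁ hA₃ (Or.inl hA₅) h1

end Summit.CriticalPhenomena.CardyFormulaZ2.Theorems.CardySelfRefinement

end
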